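import Summits.PneNP.PneNP.Theorems.ExpanderLinearGeneratorsResKWidth
import Summits.PneNP.PneNP.Theorems.ExpanderLinearGeneratorsResKPeeling
import Summits.PneNP.PneNP.Theorems.ExpanderLinearGeneratorsResKConversion
import Summits.PneNP.PneNP.Theorems.ExpanderLinearGeneratorsResKProb
import HarnessLib

/-!
# The `Res(k)` rung for expanding linear systems, VII: the random restriction

Support file for `stmt-PneNP-11443`. The expansion-preserving random restriction `rho E r c u y` of
an `(r, c)`-boundary expanding system `E : Fin m → LinEqMod 2 n`, as a function of a sample point
`(u, y)` of the uniform space `(Fin V → Fin M) × (Fin V → Bool)` (`n ≤ V`):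

* the random variable set is `J = Jset u = {v < V : u v = 0}` (each variable with probability `1/M`);
* the closure `Icl` of `J` (file I) and the assigned set `Aset = J ∪ vars(Icl)`;
* the values are `vals = solve E (peel) (extb y)` (file II) along a peeling order of the closure;
* `rho` assigns `Aset` by `vals` and nothing else.

For GOOD sample points (`|J ∩ [n]| ≤ c r / 4`) the closure has at most `r/2` rows, a peeling order
exists, the values satisfy the closure rows, and so (files IV, V) NOT every line of an
`R(k)`-refutation of `sumEncoding 1 E` can have a strong decision tree of height `H` under `rho`
when `3H < c r / 8` (`exists_line_not_ev`). Finally, the FIBER LEMMA `card_filter_solve_eq`: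
`y ↦ solve L (extb y)` is exactly `2^{|I|}`-to-one onto the solutions of the rows of `I`, for every
peeling order `L` of `I` — so counts of events about the values do not depend on the peeling order
(`card_filter_vals_eq`).

[Alekhnovich 2011, §3 (the random restriction); Segerlind–Buss–Impagliazzo 2004, §5]
-/

namespace Summit.PneNP.PneNP.Theorems.ResKRestriction

open Finset Literature.Computability.Complexity Literature.Computability.MetaComplexity

variable {m n : ℕ}

/-! ### The sample space and the restriction -/

section Defs

variable (E : Fin m → LinEqMod 2 n) (r c : ℝ) (V M : ℕ)

/-- The random variable set `J(u) = {v < V : u v = 0}`. [Alekhnovich 2011, §3] [folklore] -/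
def Jset (u : Fin V → Fin M) : Finset ℕ :=
  ((Finset.univ : Finset (Fin V)).filter fun v : Fin V => ((u v : ℕ)) = 0).map Fin.valEmbedding

/-- The closure of `J(u)`. [Alekhnovich 2011, §3] [folklore] -/
noncomputable def Icl (u : Fin V → Fin M) : Finset (Fin m) :=
  closure E r c (Jset V M u)

/-- The assigned variables `J(u) ∪ vars(closure)`. [Alekhnovich 2011, §3] [folklore] -/
noncomputable def Aset (u : Fin V → Fin M) : Finset ℕ :=
  assigned E r c (Jset V M u)

open Classical in
/-- A peeling order of the closure, if one exists (it does for good sample points). [folklore] -/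
noncomputable def peel (u : Fin V → Fin M) : List (Fin m × Fin n) :=
  if h : ∃ L, IsPeeling E (Icl E r c V M u) L then Classical.choose h else []

/-- The values of the restriction: solve the closure rows starting from the random bits `y`.
[Alekhnovich 2011, §3] [folklore] -/
noncomputable def vals (u : Fin V → Fin M) (y : Fin V → Bool) : ℕ → Bool :=
  solve E (peel E r c V M u) (extb y)

/-- **The random restriction** `ρ(u, y)`: the assigned variables get their values, all other
variables stay free. [Alekhnovich 2011, §3, Def. of `ρ`] [folklore] -/
noncomputable def rho (u : Fin V → Fin M) (y : Fin V → Bool) : ℕ → Option Bool :=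
  fun w => if w ∈ Aset E r c V M u then some (vals E r c V M u y w) else none

/-- A sample point is GOOD if the random set meets `[n]` in at most `c r / 4` variables (else the
restriction "aborts"). [Alekhnovich 2011, §3] [folklore] -/
def Good (u : Fin V → Fin M) : Prop :=
  ((sysPart n (Jset V M u)).card : ℝ) ≤ c * r / 4

/-- `Good` is (classically) decidable. [folklore] -/
noncomputable instance decGood (u : Fin V → Fin M) : Decidable (Good (n := n) r c V M u) :=
  Classical.dec _

end Defs

variable {E : Fin m → LinEqMod 2 n} {r c : ℝ} {V M : ℕ}

/-- Membership in `Jset`. [folklore] -/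
theorem mem_Jset {u : Fin V → Fin M} {w : ℕ} :
    w ∈ Jset V M u ↔ ∃ h : w < V, ((u ⟨w, h⟩ : ℕ)) = 0 := by
  simp only [Jset, Finset.mem_map, Finset.mem_filter, Finset.mem_univ, true_and,
    Fin.valEmbedding_apply]
  constructor
  · rintro ⟨v, hv, rfl⟩; exact ⟨v.2, by simpa using hv⟩
  · rintro ⟨h, hw⟩; exact ⟨⟨w, h⟩, hw, rfl⟩

/-- `|J(u) ∩ [n]| = zeros n u`. [folklore] -/
theorem card_sysPart_Jset (u : Fin V → Fin M) : (sysPart n (Jset V M u)).card = zeros n u := by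
  unfold zeros sysPart
  rw [← Finset.card_map Fin.valEmbedding]
  congr 1
  ext w
  simp only [Finset.mem_filter, mem_Jset, Finset.mem_map, Finset.mem_univ, true_and,
    Fin.valEmbedding_apply]
  constructor
  · rintro ⟨⟨h, hw⟩, hwn⟩; exact ⟨⟨w, h⟩, ⟨hwn, hw⟩, rfl⟩
  · rintro ⟨v, ⟨hvn, hv⟩, rfl⟩; exact ⟨⟨v.2, by simpa using hv⟩, hvn⟩

/-- `rho` assigns exactly `Aset`. [folklore] -/
theorem rho_eq_none_iff (u : Fin V → Fin M) (y : Fin V → Bool) (w : ℕ) :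
    rho E r c V M u y w = none ↔ w ∉ Aset E r c V M u := by
  unfold rho; split_ifs with h <;> simp [h]

/-- The value of `rho` on an assigned variable. [folklore] -/
theorem rho_of_mem {u : Fin V → Fin M} (y : Fin V → Bool) {w : ℕ} (hw : w ∈ Aset E r c V M u) :
    rho E r c V M u y w = some (vals E r c V M u y w) := by
  unfold rho; rw [if_pos hw]

/-- `J ⊆ Aset`. [folklore] -/
theorem Jset_subset_Aset (u : Fin V → Fin M) : Jset V M u ⊆ Aset E r c V M u :=
  subset_assigned

/-! ### Good sample points -/

section GoodProps

variable (hexp : IsBoundaryExpander (rowVars E) r c) (hc : 0 < c)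
include hexp hc

/-- For a good sample point the closure has at most `r/2` rows. [Alekhnovich 2011, §3] [folklore] -/
theorem two_mul_card_Icl_le {u : Fin V → Fin M} (hu : Good (n := n) r c V M u) :
    2 * ((Icl E r c V M u).card : ℝ) ≤ r :=
  two_mul_card_closure_le hexp hc hu

/-- For a good sample point every subfamily of the closure expands, so peeling orders exist.
[folklore] -/
theorem expands_of_subset_Icl {u : Fin V → Fin M} (hu : Good (n := n) r c V M u)
    {I' : Finset (Fin m)} (hI' : I' ⊆ Icl E r c V M u) :
    c * I'.card ≤ ((boundary (rowVars E) I').card : ℝ) := by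
  refine hexp I' ?_
  have h1 := two_mul_card_Icl_le hexp hc hu
  have h2 : (I'.card : ℝ) ≤ (Icl E r c V M u).card := by exact_mod_cast Finset.card_le_card hI'
  linarith

/-- For a good sample point `peel` is a peeling order of the closure. [folklore] -/
theorem isPeeling_peel {u : Fin V → Fin M} (hu : Good (n := n) r c V M u) :
    IsPeeling E (Icl E r c V M u) (peel E r c V M u) := by
  have hex : ∃ L, IsPeeling E (Icl E r c V M u) L := by
    obtain ⟨L, hL, -⟩ := exists_isPeeling_avoiding (E := E) hc (Icl E r c V M u)
      (fun I' hI' => expands_of_subset_Icl hexp hc hu hI') ∅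
    exact ⟨L, hL⟩
  unfold peel
  rw [dif_pos hex]
  exact Classical.choose_spec hex

/-- For a good sample point the values satisfy every closure row. [Alekhnovich 2011, §3] [folklore] -/
theorem holds_vals {u : Fin V → Fin M} (hu : Good (n := n) r c V M u) (y : Fin V → Bool) :
    ∀ i ∈ Icl E r c V M u, (E i).Holds (blockVals 2 1 n (vals E r c V M u y)) :=
  holds_solve (isPeeling_peel hexp hc hu) _

/-- The total assignment read off `rho` satisfies the closure rows (their variables are all
assigned). [folklore] -/
theorem holds_rho_getD {u : Fin V → Fin M} (hu : Good (n := n) r c V M u) (y : Fin V → Bool) :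
    ∀ i ∈ Icl E r c V M u,
      (E i).Holds (blockVals 2 1 n fun v => (rho E r c V M u y v).getD false) := by
  intro i hi
  have h := holds_vals hexp hc hu y i hi
  refine ((E i).holds_congr_supp fun j hj => ?_).2 h
  rw [blockVals_two_one_apply, blockVals_two_one_apply]
  have hjA : (j : ℕ) ∈ Aset E r c V M u := rowVars_subset_assigned hi (val_mem_rowVars hj)
  rw [rho_of_mem y hjA]
  rfl

/-- **No refutation has shallow strong trees everywhere (good sample points).** If `u` is good,
`r ≥ 4`, and `3H < c r / 8`, then for every `R(k)`-refutation `π` of `sumEncoding 1 E` and every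
`y` some line of `π` has NO strong decision tree of height `≤ H` under `rho u y`: otherwise the
conversion (file IV) gives a refutation of the restricted CNF of width `3H`, contradicting the
relative width bound (file V) for the `(r/2, c/2)`-expander of non-closure rows.
[Alekhnovich 2011, §4 (proof of the main theorem); Segerlind–Buss–Impagliazzo 2004, §5] [folklore] -/
theorem exists_line_not_ev {u : Fin V → Fin M} (hu : Good (n := n) r c V M u) (hr : 4 ≤ r)
    {k H : ℕ} (hH : (3 * H : ℝ) < c * r / 8) {π : List (ResKLine ℕ)}
    (hπ : IsResKRefutation k (sumEncoding 1 E) π) (y : Fin V → Bool) :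
    ∃ L ∈ π, ¬ Ev L.dnf (rho E r c V M u y) H := by
  by_contra hall
  push Not at hall
  have hder := resDerivable_empty_of_forall_ev hπ (rho E r c V M u y) hall
  refine not_resDerivable_empty_restrict (E := E) (Icl := Icl E r c V M u) (A := Aset E r c V M u)
    (ρ := rho E r c V M u y) (r' := r / 2) (c' := c / 2) (relExpander_closure E r c _)
    (by linarith) (by linarith) (fun v => rho_eq_none_iff u y v)
    (fun i hi => rowVars_subset_assigned hi) (holds_rho_getD hexp hc hu y) ?_ hder
  push_cast
  linarith

end GoodProps

/-! ### The fiber lemma for the solving map -/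

/-- Restriction of `solve L (extb y)` to `Fin V`. [folklore] -/
noncomputable def solveFin (E : Fin m → LinEqMod 2 n) (L : List (Fin m × Fin n)) {V : ℕ}
    (y : Fin V → Bool) : Fin V → Bool :=
  fun v => solve E L (extb y) v

/-- `extb (solveFin y) = solve L (extb y)` when `n ≤ V` (the solving map changes only pivots,
which are `< n`). [folklore] -/
theorem extb_solveFin (L : List (Fin m × Fin n)) (hnV : n ≤ V) (y : Fin V → Bool) :
    extb (solveFin E L y) = solve E L (extb y) := by
  funext w
  by_cases hw : w < V
  · have : extb (solveFin E L y) w = solveFin E L y ⟨w, hw⟩ := extb_apply_fin _ ⟨w, hw⟩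
    rw [this]; rfl
  · push Not at hw
    rw [extb_apply_of_le _ hw, solve_apply_of_le L _ (hnV.trans hw), extb_apply_of_le _ hw]

/-- The pivots of `L`, as coordinates of `Fin V`. [folklore] -/
def pivFin (L : List (Fin m × Fin n)) (V : ℕ) (hnV : n ≤ V) : Finset (Fin V) :=
  (L.map fun e => (⟨e.2, lt_of_lt_of_le e.2.2 hnV⟩ : Fin V)).toFinset

/-- A peeling order has `|I|` pivots. [folklore] -/
theorem card_pivFin {I : Finset (Fin m)} {L : List (Fin m × Fin n)} (hL : IsPeeling E I L)
    (hnV : n ≤ V) : (pivFin L V hnV).card = I.card := by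
  unfold pivFin
  rw [List.toFinset_card_of_nodup, List.length_map, hL.length_eq]
  have h := hL.nodup_pivots
  rw [show (L.map fun e => (⟨e.2, lt_of_lt_of_le e.2.2 hnV⟩ : Fin V)) =
      (L.map Prod.snd).map fun j : Fin n => (⟨j, lt_of_lt_of_le j.2 hnV⟩ : Fin V) by simp]
  exact h.map fun j j' hjj' => Fin.ext (by simpa using congrArg Fin.val hjj')

/-- Non-pivot coordinates are untouched by the solving map. [folklore] -/
theorem solveFin_apply_of_not_mem {L : List (Fin m × Fin n)} {hnV : n ≤ V} {v : Fin V}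
    (hv : v ∉ pivFin L V hnV) (y : Fin V → Bool) : solveFin E L y v = y v := by
  unfold solveFin
  rw [solve_apply_of_forall_ne L _ fun e he heq => hv ?_, extb_apply_fin]
  unfold pivFin
  rw [List.mem_toFinset, List.mem_map]
  exact ⟨e, he, Fin.ext heq⟩

/-- **The fibers of the solving map.** For a peeling order `L` of `I` and a solution `x` of the rows
of `I` (read through `extb`), the `y` with `solveFin y = x` are exactly the `y` agreeing with `x`
off the pivots. [folklore] -/
theorem solveFin_eq_iff {I : Finset (Fin m)} {L : List (Fin m × Fin n)} (hL : IsPeeling E I L)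
    (hnV : n ≤ V) {x : Fin V → Bool} (hx : ∀ i ∈ I, (E i).Holds (blockVals 2 1 n (extb x)))
    (y : Fin V → Bool) :
    solveFin E L y = x ↔ ∀ v, v ∉ pivFin L V hnV → y v = x v := by
  constructor
  · intro h v hv
    rw [← h, solveFin_apply_of_not_mem hv]
  · intro h
    have key : solve E L (extb y) = extb x := by
      refine solve_eq_of_agree_off_pivots hL hx fun w hw => ?_
      by_cases hwV : w < V
      · have hv : (⟨w, hwV⟩ : Fin V) ∉ pivFin L V hnV := by
          unfold pivFin
          rw [List.mem_toFinset, List.mem_map]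
          rintro ⟨e, he, heq⟩
          exact hw e he (by simpa using congrArg Fin.val heq)
        have := h _ hv
        rw [← extb_apply_fin y ⟨w, hwV⟩, ← extb_apply_fin x ⟨w, hwV⟩] at this
        exact this
      · push Not at hwV
        rw [extb_apply_of_le _ hwV, extb_apply_of_le _ hwV]
    funext v
    have := congrFun key v
    rw [extb_apply_fin] at this
    exact this

/-- **The fiber lemma.** For a peeling order `L` of `I` (`n ≤ V`) and any property `Q` of total
assignments: `#{y : Q (solve L (extb y))} = 2^{|I|} · #{x : the rows of I hold under extb x ∧ Q (extb x)}`.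
[folklore] -/
theorem card_filter_solve_eq {I : Finset (Fin m)} {L : List (Fin m × Fin n)} (hL : IsPeeling E I L)
    (hnV : n ≤ V) (Q : (ℕ → Bool) → Prop) [DecidablePred Q] :
    ((Finset.univ : Finset (Fin V → Bool)).filter fun y => Q (solve E L (extb y))).card =
      2 ^ I.card * ((Finset.univ : Finset (Fin V → Bool)).filter fun x =>
        (∀ i ∈ I, (E i).Holds (blockVals 2 1 n (extb x))) ∧ Q (extb x)).card := by
  classical
  set S := (Finset.univ : Finset (Fin V → Bool)).filter fun y => Q (solve E L (extb y)) with hS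
  set T := (Finset.univ : Finset (Fin V → Bool)).filter fun x =>
    (∀ i ∈ I, (E i).Holds (blockVals 2 1 n (extb x))) ∧ Q (extb x) with hT
  have hmaps : Set.MapsTo (solveFin E L) (S : Set (Fin V → Bool)) (T : Set (Fin V → Bool)) := by
    intro y hy
    rw [Finset.mem_coe, hS, Finset.mem_filter] at hy
    rw [Finset.mem_coe, hT, Finset.mem_filter, extb_solveFin L hnV]
    exact ⟨Finset.mem_univ _, holds_solve hL _, hy.2⟩
  rw [Finset.card_eq_sum_card_fiberwise hmaps]
  have hfib : ∀ x ∈ T, (S.filter fun y => solveFin E L y = x).card = 2 ^ I.card := by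
    intro x hx
    rw [hT, Finset.mem_filter] at hx
    obtain ⟨-, hxrows, hxQ⟩ := hx
    have heq : (S.filter fun y => solveFin E L y = x) =
        (Finset.univ : Finset (Fin V → Bool)).filter fun y =>
          ∀ v ∈ Finset.univ \ pivFin L V hnV, y v = x v := by
      ext y
      simp only [hS, Finset.mem_filter, Finset.mem_univ, true_and, Finset.mem_sdiff]
      rw [solveFin_eq_iff hL hnV hxrows]
      constructor
      · rintro ⟨-, h⟩ v hv; exact h v hv
      · intro h
        have h' : ∀ v, v ∉ pivFin L V hnV → y v = x v := fun v hv => h v hv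
        refine ⟨?_, h'⟩
        have := (solveFin_eq_iff hL hnV hxrows y).2 h'
        rw [← extb_solveFin L hnV, this]
        exact hxQ
    have h2 : ((Finset.univ : Finset (Fin V → Bool)).filter fun y =>
          ∀ v ∈ Finset.univ \ pivFin L V hnV, y v = x v).card =
        2 ^ (V - (Finset.univ \ pivFin L V hnV).card) := by
      simpa using card_filter_eqOn (κ := Bool) (Finset.univ \ pivFin L V hnV) x
    rw [heq, h2, Finset.card_sdiff_of_subset (Finset.subset_univ _), Finset.card_univ,
      Fintype.card_fin, card_pivFin hL hnV]
    congr 1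
    have : I.card ≤ V := by
      rw [← card_pivFin hL hnV]; exact (Finset.card_le_univ _).trans (by simp)
    omega
  rw [Finset.sum_congr rfl hfib, Finset.sum_const, smul_eq_mul, mul_comm]

/-- **Counts of value events do not depend on the peeling order.** For a good sample point `u`
and ANY peeling order `L'` of the closure, `#{y : Q (vals u y)} = #{y : Q (solve L' (extb y))}`.
[folklore] -/
theorem card_filter_vals_eq (hexp : IsBoundaryExpander (rowVars E) r c) (hc : 0 < c)
    {u : Fin V → Fin M} (hu : Good (n := n) r c V M u) (hnV : n ≤ V) {L' : List (Fin m × Fin n)}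
    (hL' : IsPeeling E (Icl E r c V M u) L') (Q : (ℕ → Bool) → Prop) [DecidablePred Q] :
    ((Finset.univ : Finset (Fin V → Bool)).filter fun y => Q (vals E r c V M u y)).card =
      ((Finset.univ : Finset (Fin V → Bool)).filter fun y => Q (solve E L' (extb y))).card := by
  unfold vals
  rw [card_filter_solve_eq (isPeeling_peel hexp hc hu) hnV Q, card_filter_solve_eq hL' hnV Q]

end Summit.PneNP.PneNP.Theorems.ResKRestriction
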